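import Summits.ResolutionOfSingularities.ResolutionOfSingularities.Theorems.FrobeniusClosingPatchingRelPerfectDepthPhaseCLocalGameCentres
import Summits.ResolutionOfSingularities.ResolutionOfSingularities.Theorems.FrobeniusClosingPatchingRelPerfectDepthPhaseCLocalGamePersistenceHolds
import HarnessLib

/-!
# [OURS · L1 W5.2 · (β-AX) X3 C-I (G-T) (iii′)] THE GLOBAL MOVE UNDER (H-pt): blowing up an irreducible component of a top locus

Sub-problem `ResolutionOfSingularities`, crux `PatchingRelPerfect` (stmt-ResolutionOfSingularities-16161), line
`Cruxes/PatchingRelPerfect/Lines/closed_point_slice.lean`, engine (G2), Props `X3LemmaM.EndSingComponentsRegular` (G-R, p571605) and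
`X3LemmaM.EndStratumStep` (G-P, res-D-pv-046 p571914) of `…DepthPhaseCX3Defs`.

res-D-pv-001 (iii′) NOTE 1 §3: under the END notion of record (H-pt) the IRREDUCIBLE COMPONENTS OF THE ORDER LOCI `singGE K c` are intrinsic,
GLOBAL, regular, and locally single strata of the local letters — so they are legal END-preserving centres with NO patching and NO invariant
gluing.  This file composes (G-R) and (G-P) into that move:

* §1 `singGE_antitone` — `singGE K c ⊆ singGE K m` for `m ≤ c`; `comap_vanishingIdeal_eq_foldr_sup` — the set-level stratum description
  delivered by (G-R) (`Y ∩ U = ⋂_{F ∈ J} Supp F ∩ U`) is the ideal-level one consumed by (G-P) (`𝓘_Y|_U = (Σ_{F ∈ J} F)|_U`), because a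
  stratum ideal of snc letters is the vanishing ideal of its support (regular ⇒ reduced).
* §2 **`endGlobalStep`** — `X` regular Noetherian, `K` locally END (letters `𝓛`), `1 ≤ m ≤ c`, `Y` an irreducible component of `singGE K c`:
  `Bl_Y X` is regular Noetherian, `K·𝒪 = (𝓘_Y·𝒪)^m · K₁` with `(𝓘_Y·𝒪)^m` effective Cartier, `K₁` again locally END, `cosupp K₁` over
  `cosupp K`; and **`endGlobalStep_centreSeq`** — the same as a one-centre `CentreSeq` with the factorization package of
  `endOrderReduction_of_closedPieces` (centres over `Y`, `cosupp M` over `Y`).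

What is NOT here: a termination theorem for a strategy made of such moves ((iii′) NOTE 1 §4–§5: the combinatorial problem).

## References
* J. Kollár, *Lectures on Resolution of Singularities* (2007), (3.111) Step 3, Def. 3.25, Def. 3.65. [Kollar2007]
* E. Bierstone, P. Milman, *Desingularization of toric and binomial varieties* (2006), arXiv:math/0411340, §4 Step 2 (b), Lemma 8.7. [BierstoneMilman2006]
* The Stacks Project, Tags 0357, 01J3. [StacksProject]
-/

-- `Summit.<Summit>.<Sub>.Theorems` with `Sub = Summit` (single-conjunct summit, D-0017)
set_option linter.dupNamespace false

noncomputable section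

namespace Summit.ResolutionOfSingularities.ResolutionOfSingularities.Theorems.X3LemmaM

open CategoryTheory AlgebraicGeometry TopologicalSpace IsLocalRing
open Literature.AlgebraicGeometry.Resolution
open Scheme.IdealSheafData

universe u

variable {X : Scheme.{u}}

/-! ## §1 Tools -/

/-- The order loci decrease with the threshold: `singGE K c ⊆ singGE K m` for `m ≤ c`. [cite: BierstoneGrigorievMilmanWlodarczyk2011, Def. 3.1.2] -/
theorem singGE_antitone (K : X.IdealSheafData) {m c : ℕ} (hmc : m ≤ c) : singGE K c ⊆ singGE K m := by
  intro x hx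
  have h := (MarkedIdeal.mem_support_iff (⟨K, [], c⟩ : MarkedIdeal X) x).mp hx
  exact (MarkedIdeal.mem_support_iff (⟨K, [], m⟩ : MarkedIdeal X) x).mpr (h.trans (Ideal.pow_le_pow_right hmc))

/-- **The set-level stratum description is the ideal-level one**: if `Y ∩ U = ⋂_{F ∈ J} Supp F ∩ U` for a sub-family `J` of letters `Λ`
that are snc on `U`, then `𝓘_Y|_U = (Σ_{F ∈ J} F)|_U` (the stratum ideal is regular, hence the vanishing ideal of its support).
[cite: Kollar2007, Def. 3.25] [cite: StacksProject, Tag 01J3] -/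
theorem comap_vanishingIdeal_eq_foldr_sup [IsLocallyNoetherian X] {Y : Set X} (hY : IsClosed Y) (U : X.Opens)
    {Λ J : List X.IdealSheafData} (hsnc : HasSNC (Λ.map fun F => F.comap U.ι)) (hJ : ∀ F ∈ J, F ∈ Λ)
    (hYU : Y ∩ (U : Set X) = (⋂ F ∈ J, (F.support : Set X)) ∩ (U : Set X)) :
    (vanishingIdeal ⟨Y, hY⟩).comap U.ι = (J.foldr (· ⊔ ·) ⊥).comap U.ι := by
  classical
  haveI : IsLocallyNoetherian (U : Scheme.{u}) := isLocallyNoetherian_of_isOpenImmersion U.ι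
  rw [comap_foldr_sup, List.foldr_sup_eq_sup_toFinset]
  set T : Finset (U : Scheme.{u}).IdealSheafData := (J.map fun F => F.comap U.ι).toFinset with hT
  have hTΛ : ∀ G ∈ T, G ∈ Λ.map fun F => F.comap U.ι := fun G hG => by
    obtain ⟨F, hF, rfl⟩ := List.mem_map.mp (List.mem_toFinset.mp hG)
    exact List.mem_map.mpr ⟨F, hJ F hF, rfl⟩
  have hreg : Scheme.IsRegular (T.sup id).subscheme := hsnc.isRegular_subscheme_finsetSup T hTΛ
  rw [eq_vanishingIdeal_support_of_isRegular _ hreg, comap_vanishingIdeal_of_isOpenImmersion]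
  congr 1
  apply TopologicalSpace.Closeds.ext
  ext u
  rw [TopologicalSpace.Closeds.coe_preimage, Set.mem_preimage, SetLike.mem_coe, SetLike.mem_coe, mem_support_finsetSup_iff]
  constructor
  · intro hu G hG
    obtain ⟨F, hF, rfl⟩ := List.mem_map.mp (List.mem_toFinset.mp hG)
    have h1 : (U.ι.base u : X) ∈ Y ∩ (U : Set X) := ⟨hu, u.2⟩
    rw [hYU] at h1
    have h2 := Set.mem_iInter₂.mp h1.1 F hF
    change u ∈ (F.comap U.ι).support
    exact (mem_support_comap_iff U.ι F u).mpr h2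
  · intro h
    have h1 : (U.ι.base u : X) ∈ (⋂ F ∈ J, (F.support : Set X)) ∩ (U : Set X) :=
      ⟨Set.mem_iInter₂.mpr fun F hF =>
        (mem_support_comap_iff U.ι F u).mp (h (F.comap U.ι) (List.mem_toFinset.mpr (List.mem_map.mpr ⟨F, hF, rfl⟩))), u.2⟩
    rw [← hYU] at h1
    exact h1.1

/-! ## §2 The global move -/

/-- [OURS · L1 W5.2 · (iii′)] **THE GLOBAL MOVE UNDER (H-pt).**  `X` regular Noetherian, `K` locally END at every point of its cosupport
(letters `𝓛`), `1 ≤ m ≤ c`, `Y` an IRREDUCIBLE COMPONENT of the order locus `singGE K c` (a maximal irreducible subset).  Then `Y` is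
closed, the blow-up of `X` along `𝓘_Y` is regular and Noetherian, `K·𝒪 = (𝓘_Y·𝒪)^m · K₁` with `(𝓘_Y·𝒪)^m` effective Cartier, `K₁` is
again locally END at every point of its cosupport (letters: strict transforms and the exceptional divisor), and `cosupp K₁` lies over
`cosupp K`.  ((G-R) `endSingComponentsRegular_holds` gives regularity of `Y` and its local stratum description; (G-P) `endStratumStep_holds`
blows it up; §1 translates between them.) [cite: Kollar2007, (3.111) Step 3, Def. 3.65] [cite: BierstoneMilman2006, §4 Step 2 (b)] -/
theorem endGlobalStep [IsNoetherian X] (hX : Scheme.IsRegular X) (K : X.IdealSheafData) (𝓛 : List X.IdealSheafData) {m c : ℕ}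
    (hm : 1 ≤ m) (hmc : m ≤ c) (hEnd : ∀ x ∈ (K.support : Set X), IsEndNear K 𝓛 x) {Y : Set X} (hYirr : IsIrreducible Y)
    (hYsub : Y ⊆ singGE K c) (hYmax : ∀ Y' : Set X, IsIrreducible Y' → Y ⊆ Y' → Y' ⊆ singGE K c → Y' = Y) :
    ∃ hY : IsClosed Y,
      Scheme.IsRegular (blowup (vanishingIdeal ⟨Y, hY⟩)) ∧
      ∃ (_ : IsNoetherian (blowup (vanishingIdeal ⟨Y, hY⟩))) (M K₁ : (blowup (vanishingIdeal ⟨Y, hY⟩)).IdealSheafData)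
        (𝓛₁ : List (blowup (vanishingIdeal ⟨Y, hY⟩)).IdealSheafData),
        K.comap (blowup.π (vanishingIdeal ⟨Y, hY⟩)) = M * K₁ ∧ IsEffectiveCartier M ∧
        M = ((vanishingIdeal ⟨Y, hY⟩).comap (blowup.π (vanishingIdeal ⟨Y, hY⟩))) ^ m ∧
        (∀ x ∈ (K₁.support : Set (blowup (vanishingIdeal ⟨Y, hY⟩))), IsEndNear K₁ 𝓛₁ x) ∧
        (K₁.support : Set (blowup (vanishingIdeal ⟨Y, hY⟩))) ⊆ blowup.π (vanishingIdeal ⟨Y, hY⟩) ⁻¹' (K.support : Set X) := by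
  obtain ⟨hY, hreg, hstr⟩ := endSingComponentsRegular_holds X hX K 𝓛 c (hm.trans hmc) hEnd Y hYirr hYsub hYmax
  refine ⟨hY, ?_⟩
  have hsupp : ((vanishingIdeal ⟨Y, hY⟩).support : Set X) ⊆ singGE K m := by
    rw [Scheme.IdealSheafData.coe_support_vanishingIdeal]
    exact hYsub.trans (singGE_antitone K hmc)
  have hCstr : ∀ y ∈ ((vanishingIdeal ⟨Y, hY⟩).support : Set X),
      ∃ (U : X.Opens) (Λ J : List X.IdealSheafData) (𝒦 : List (List (X.IdealSheafData × ℕ))),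
        IsEndPresentation K 𝓛 y U Λ 𝒦 ∧ (∀ F ∈ J, F ∈ Λ) ∧
          (vanishingIdeal ⟨Y, hY⟩).comap U.ι = (J.foldr (· ⊔ ·) ⊥).comap U.ι := by
    intro y hy
    rw [Scheme.IdealSheafData.coe_support_vanishingIdeal] at hy
    obtain ⟨U, Λ, J, 𝒦, hpres, hJ, hYU⟩ := hstr y hy
    exact ⟨U, Λ, J, 𝒦, hpres, hJ, comap_vanishingIdeal_eq_foldr_sup hY U hpres.2.2.1 hJ hYU⟩
  exact endStratumStep_holds X hX K (vanishingIdeal ⟨Y, hY⟩) 𝓛 m hm hEnd hreg hsupp hCstr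

/-- [OURS · L1 W5.2 · (iii′)] **The global move as a one-centre blow-up sequence with the factorization package** of
`endOrderReduction_of_closedPieces` / `exists_factorization_extend`: regular centre over `Y`, regular Noetherian top, `K·𝒪 = M · K₁`,
`M` effective Cartier cosupported over `Y`, `K₁` locally END on its cosupport, `cosupp K₁` over `cosupp K`.
[cite: Kollar2007, (3.111) Step 3] [cite: BierstoneMilman2006, Lemma 8.7] -/
theorem endGlobalStep_centreSeq [IsNoetherian X] (hX : Scheme.IsRegular X) (K : X.IdealSheafData) (𝓛 : List X.IdealSheafData)
    {m c : ℕ} (hm : 1 ≤ m) (hmc : m ≤ c) (hEnd : ∀ x ∈ (K.support : Set X), IsEndNear K 𝓛 x) {Y : Set X}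
    (hYirr : IsIrreducible Y) (hYsub : Y ⊆ singGE K c)
    (hYmax : ∀ Y' : Set X, IsIrreducible Y' → Y ⊆ Y' → Y' ⊆ singGE K c → Y' = Y) :
    ∃ s : CentreSeq X, s.AllRegular ∧ s.CentresOver Y ∧ Scheme.IsRegular s.top ∧
      ∃ (_ : IsNoetherian s.top) (M K₁ : s.top.IdealSheafData) (𝓛₁ : List s.top.IdealSheafData),
        K.comap s.comp = M * K₁ ∧ IsEffectiveCartier M ∧ (M.support : Set s.top) ⊆ s.comp.base ⁻¹' Y ∧
        (∀ x ∈ (K₁.support : Set s.top), IsEndNear K₁ 𝓛₁ x) ∧ (K₁.support : Set s.top) ⊆ s.comp.base ⁻¹' (K.support : Set X) := by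
  obtain ⟨hY, hreg, hN, M, K₁, 𝓛₁, hfac, hM, hMeq, hend₁, hsupp₁⟩ := endGlobalStep hX K 𝓛 hm hmc hEnd hYirr hYsub hYmax
  have hCY : ((vanishingIdeal (⟨Y, hY⟩ : Closeds X)).support : Set X) = Y :=
    Scheme.IdealSheafData.coe_support_vanishingIdeal (⟨Y, hY⟩ : Closeds X)
  have hCreg : Scheme.IsRegular (vanishingIdeal (⟨Y, hY⟩ : Closeds X)).subscheme :=
    (endSingComponentsRegular_holds X hX K 𝓛 c (hm.trans hmc) hEnd Y hYirr hYsub hYmax).2.1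
  have hm0 : m ≠ 0 := by
    rintro rfl
    exact Nat.not_succ_le_zero 0 hm
  refine ⟨.cons (vanishingIdeal (⟨Y, hY⟩ : Closeds X)) (.nil _), ⟨hCreg, trivial⟩, ⟨hCY.le, trivial⟩, hreg, hN, M, K₁, 𝓛₁,
    ?_, hM, ?_, hend₁, ?_⟩
  · change K.comap (𝟙 _ ≫ blowup.π (vanishingIdeal (⟨Y, hY⟩ : Closeds X))) = M * K₁
    rw [Category.id_comp]
    exact hfac
  · intro y hy
    change (𝟙 _ ≫ blowup.π (vanishingIdeal (⟨Y, hY⟩ : Closeds X))).base y ∈ Y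
    rw [Category.id_comp]
    have hy' : y ∈ ((((vanishingIdeal (⟨Y, hY⟩ : Closeds X)).comap (blowup.π (vanishingIdeal (⟨Y, hY⟩ : Closeds X)))) ^ m).support :
        Set (blowup (vanishingIdeal (⟨Y, hY⟩ : Closeds X)))) := by
      rw [hMeq] at hy
      exact hy
    rw [Scheme.IdealSheafData.support_pow _ _ hm0] at hy'
    have h := (mem_support_comap_iff (blowup.π (vanishingIdeal (⟨Y, hY⟩ : Closeds X))) _ y).mp hy'
    rw [hCY] at h
    exact h
  · intro y hy
    change (𝟙 _ ≫ blowup.π (vanishingIdeal (⟨Y, hY⟩ : Closeds X))).base y ∈ (K.support : Set X)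
    rw [Category.id_comp]
    exact hsupp₁ hy

end Summit.ResolutionOfSingularities.ResolutionOfSingularities.Theorems.X3LemmaM

end
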